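import Summits.ResolutionOfSingularities.ResolutionOfSingularities.Theorems.PolygonLawPort
import Summits.ResolutionOfSingularities.ResolutionOfSingularities.Theorems.SurfacePortBridge
import HarnessLib

/-!
# PolygonLawRoot — «PolygonLaw» FILE C (decomp-res lens-4, g43): CELLS, KILL, RE-LOCATION (§152) AND THE ROOT WITH 14 BINDERS (§153)

Third slice of the g43 node «PolygonLaw» (node header: `Theorems/PolygonLawKernel.lean`; port: `Theorems/PolygonLawPort.lean`).  §152: the
g42 located core C₃♮ʳᶠ♯ᵏ♯ᵉᶠ «flagged doubly narrow» (Theorems/ConeChainCells :76, untouched) KILLED ABSOLUTELY by LAW D (a threefold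
class), CELL C₃ «occult divisorial threefold» (g34) DECIDED BY NAME, CELL C re-located hypothesis-free onto C₄, the located residual
after g43 `NoWildOccultNonThreefoldMixedTowers := hC4 ∧ hD4` with the em-exact `…_iff_g43` and down-links by name.  §153: the root
consumers `ftt_step_of_g43`, `forcedTowersTerminate_of_g43`, `noForcedTowers_of_g43 : … → MaxContactCut.NoForcedTowers` = g42's with
EXACTLY `hcore` (killed) and `h640` (proved) removed — 14 binders hMo hC hSL hH hP hM hRi h71 hB hC4 hD4 hNP hPu hR, all still
HYPOTHESES (structural ports, hugging columns, non-threefold mixed cells, latency / purity / rider leaves); `_residual` twin (13 binders);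
MAP rider `cjs2020_noInfiniteNearChain_eTwo_holds` (a Literature `def : Prop` fact discharged in the kernel via the landed bridge).
AI-written; AI review weaker than expert review.  `MaxContactCut.NoForcedTowers` (30253) is NOT proved.  No named facts, no sorry.
-/

noncomputable section

set_option linter.dupNamespace false

open CategoryTheory CategoryTheory.Limits AlgebraicGeometry TopologicalSpace IsLocalRing MvPolynomial
open Literature.AlgebraicGeometry.Resolution Scheme.IdealSheafData
open Summit.ResolutionOfSingularities.ResolutionOfSingularities.Theorems
open WeakOrderReduction ForcedTowerClasses DivergentTowerClasses MonomialTowerClasses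
open HugDimensionClasses HugDimensionKernels SurfaceShadowClasses SurfaceShadowKernels
open NearPointCut (SingularClass)

namespace Summit.ResolutionOfSingularities.ResolutionOfSingularities.Theorems.HugValuationCut

universe u

/-! ## ══ FILE C `Theorems/PolygonLawRoot.lean` (§152–§153; imports FILE B and the LANDED `SurfacePortBridge`; the only file opening `…Theses`) ══ -/

section PolygonLawCells

/-! ## §152 (g43 · CELLS, KILL, RE-LOCATION) the g42 located core C₃♮ʳᶠ♯ᵏ♯ᵉᶠ (Theorems/ConeChainCells :76, VERBATIM, untouched) KILLED
ABSOLUTELY by LAW D (it is a threefold class); CELL C₃ «occult divisorial threefold» (Theorems/CurveCutCells :71) DECIDED BY NAME; the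
located residual re-located em-exactly onto the two NON-THREEFOLD occult cells C₄ ∧ D₄ (existing root binders hC4, hD4 — no new letter) -/

/-- **THE KILL — THE g42 LOCATED CORE C₃♮ʳᶠ♯ᵏ♯ᵉᶠ «FLAGGED DOUBLY NARROW» IS EMPTY, ABSOLUTELY** (every `p ∣ n`, every field, every
weight `n ≥ 1`; port-free, no `MinimalAt`): LAW D `noTower_threefold` against the cell's conjunct `ThreefoldTower T`. [NEW] -/
theorem wildOccultDivisorialThreefoldNonLineRecurrentCompanionCurveFreeBirthRecurrentCofactorBirthRecurrentNarrowCofactorNarrowFlagProperConeMixed_holds (n : ℕ) (hn : 1 ≤ n) :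
    WildOccultDivisorialThreefoldNonLineRecurrentCompanionCurveFreeBirthRecurrentCofactorBirthRecurrentNarrowCofactorNarrowFlagProperConeMixedWallFreeFreshJumpShallowCompanionKangarooTowersTerminate n := by
  intro p hp _ k _ _ T g hB hD hE hP
  exact noTower_threefold hn (fun _ => True) p hp k T g hB hD hE ⟨trivial, hP.1.1.1.1.1.1.1.1.1.2⟩

/-- **THE g42 LOCATED CORE DECIDED BY NAME — ABSOLUTELY (closed term, hypothesis-free).** [NEW] -/
theorem noWildOccultDivisorialThreefoldNonLineRecurrentCompanionCurveFreeBirthRecurrentCofactorBirthRecurrentNarrowCofactorNarrowFlagProperConeMixedTowers_holds :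
    NoWildOccultDivisorialThreefoldNonLineRecurrentCompanionCurveFreeBirthRecurrentCofactorBirthRecurrentNarrowCofactorNarrowFlagProperConeMixedTowers := fun n hn =>
  wildOccultDivisorialThreefoldNonLineRecurrentCompanionCurveFreeBirthRecurrentCofactorBirthRecurrentNarrowCofactorNarrowFlagProperConeMixed_holds n hn

/-- **CELL C₃ «OCCULT DIVISORIAL THREEFOLD» (g34's cut of CELL C by ring dimension, Theorems/CurveCutCells :71) IS EMPTY, ABSOLUTELY**
— the ancestor of every located core since g35: LAW D against its conjunct `ThreefoldTower T`. [NEW] -/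
theorem wildOccultDivisorialThreefoldMixed_holds (n : ℕ) (hn : 1 ≤ n) :
    WildOccultDivisorialThreefoldMixedWallFreeFreshJumpShallowCompanionKangarooTowersTerminate n := by
  intro p hp _ k _ _ T g hB hD hE hP
  exact noTower_threefold hn (fun _ => True) p hp k T g hB hD hE ⟨trivial, hP.2⟩

/-- **CELL C₃ DECIDED BY NAME — ABSOLUTELY (closed term).** [NEW] -/
theorem noWildOccultDivisorialThreefoldMixedTowers_holds : NoWildOccultDivisorialThreefoldMixedTowers := fun n hn =>
  wildOccultDivisorialThreefoldMixed_holds n hn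

/-- **CELL C (g33's located residual «occult divisorial», Theorems/FactorCutCells :179) RE-LOCATED HYPOTHESIS-FREE onto its
NON-THREEFOLD half C₄** (g34's dimension cut `wildOccultDivisorialMixed_split` + the C₃ kill). [NEW] -/
theorem noWildOccultDivisorialMixedTowers_iff_nonThreefold :
    NoWildOccultDivisorialMixedTowers ↔ NoWildOccultDivisorialNonThreefoldMixedTowers :=
  ⟨fun h n hn => ((wildOccultDivisorialMixed_split n).mp (h n hn)).2,
    fun h n hn => (wildOccultDivisorialMixed_split n).mpr ⟨wildOccultDivisorialThreefoldMixed_holds n hn, h n hn⟩⟩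

/-- BY NAME: **THE LOCATED RESIDUAL of the lens-4 NP column after g43 — «no wild occult NON-THREEFOLD mixed tower»** = C₄ ∧ D₄, the
conjunction of the two EXISTING root binders `hC4 ∧ hD4` (both UNDECIDED · EXPECTED-HABITAT ring dimension 4; no new letter). -/
def NoWildOccultNonThreefoldMixedTowers : Prop :=
  NoWildOccultDivisorialNonThreefoldMixedTowers ∧ NoWildOccultNonDivisorialNonThreefoldMixedTowers

/-- **EXACT RE-LOCATION BY NAME, HYPOTHESIS-FREE: the g42 located residual ⟺ the g43 located residual** (the core conjunct is decided
absolutely; pure logic otherwise). [NEW] -/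
theorem noWildOccultFlaggedDoublyNarrowCofactorBirthRecurrentCurveFreeCompanionNonLineMixedTowers_iff_g43 :
    NoWildOccultFlaggedDoublyNarrowCofactorBirthRecurrentCurveFreeCompanionNonLineMixedTowers ↔ NoWildOccultNonThreefoldMixedTowers :=
  ⟨fun h => ⟨h.1.2, h.2⟩, fun h => ⟨⟨noWildOccultDivisorialThreefoldNonLineRecurrentCompanionCurveFreeBirthRecurrentCofactorBirthRecurrentNarrowCofactorNarrowFlagProperConeMixedTowers_holds, h.1⟩, h.2⟩⟩

/-- down-link (HYPOTHESIS-FREE): the g43 located residual ⟸ the g42 located residual. [folklore] -/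
theorem noWildOccultNonThreefoldMixedTowers_of_g42 (h : NoWildOccultFlaggedDoublyNarrowCofactorBirthRecurrentCurveFreeCompanionNonLineMixedTowers) :
    NoWildOccultNonThreefoldMixedTowers :=
  noWildOccultFlaggedDoublyNarrowCofactorBirthRecurrentCurveFreeCompanionNonLineMixedTowers_iff_g43.mp h

/-- up-link (HYPOTHESIS-FREE): the g43 located residual ⟹ the g42 located residual (nothing is lost). [folklore] -/
theorem noWildOccultFlaggedDoublyNarrowCofactorBirthRecurrentCurveFreeCompanionNonLineMixedTowers_of_g43 (h : NoWildOccultNonThreefoldMixedTowers) :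
    NoWildOccultFlaggedDoublyNarrowCofactorBirthRecurrentCurveFreeCompanionNonLineMixedTowers :=
  noWildOccultFlaggedDoublyNarrowCofactorBirthRecurrentCurveFreeCompanionNonLineMixedTowers_iff_g43.mpr h

/-- down-link (HYPOTHESIS-FREE): the g43 located residual ⟸ the g41 located residual. [folklore] -/
theorem noWildOccultNonThreefoldMixedTowers_of_g41 (h : NoWildOccultDoublyNarrowCofactorBirthRecurrentCurveFreeCompanionNonLineMixedTowers) :
    NoWildOccultNonThreefoldMixedTowers :=
  noWildOccultNonThreefoldMixedTowers_of_g42 (noWildOccultFlaggedDoublyNarrowCofactorBirthRecurrentCurveFreeCompanionNonLineMixedTowers_of_g41 h)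

/-- down-link (HYPOTHESIS-FREE): the g43 located residual ⟸ the g39 located residual. [folklore] -/
theorem noWildOccultNonThreefoldMixedTowers_of_g39 (h : NoWildOccultCofactorBirthRecurrentCurveFreeCompanionNonLineMixedTowers) :
    NoWildOccultNonThreefoldMixedTowers :=
  noWildOccultNonThreefoldMixedTowers_of_g42 (noWildOccultFlaggedDoublyNarrowCofactorBirthRecurrentCurveFreeCompanionNonLineMixedTowers_of_g39 h)

/-- down-link (HYPOTHESIS-FREE): the g43 located residual ⟸ the g36 located residual. [folklore] -/
theorem noWildOccultNonThreefoldMixedTowers_of_g36 (h : NoWildOccultRecurrentCompanionNonLineMixedTowers) :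
    NoWildOccultNonThreefoldMixedTowers :=
  noWildOccultNonThreefoldMixedTowers_of_g42 (noWildOccultFlaggedDoublyNarrowCofactorBirthRecurrentCurveFreeCompanionNonLineMixedTowers_of_g36 h)

end PolygonLawCells

/-! ## §153 (g43 · ROOT) THE ROOT CONSUMERS WITH `hcore` AND `h640` DISCHARGED — EVERY OTHER BINDER VERBATIM (g42's
`noForcedTowers_of_g42`, Theorems/ConeChainRoot :64: 16 → 14 binders) -/

section PolygonLawRoot

open Summit.ResolutionOfSingularities.ResolutionOfSingularities.Theses

/-- **the weight-`n` step from the g43 cells**: g42's `ftt_step_of_g42` with the port `h640` PROVED (`surfaceChainPort_holds`) and the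
core cell `hK` KILLED (`…FlagProperConeMixed_holds`); nothing else changed. [folklore] -/
theorem ftt_step_of_g43 {n : ℕ} (hn : 1 ≤ n) (hMo : MonomialCorner n) (hC : CurveLaw n) (hSL : SurfaceLaw n)
    (hH : HypersurfaceHuggingTowersTerminate n) (hP : ShadowPort n) (hM : MarkingPort n)
    (hRi : RiderPort n) (h71 : ContactHuggingTowersTerminate n)
    (hB : WildLatentFactorNonThreefoldMixedWallFreeFreshJumpShallowCompanionKangarooTowersTerminate n)
    (hC4 : WildOccultDivisorialNonThreefoldMixedWallFreeFreshJumpShallowCompanionKangarooTowersTerminate n)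
    (hD4 : WildOccultNonDivisorialNonThreefoldMixedWallFreeFreshJumpShallowCompanionKangarooTowersTerminate n)
    (hNP : ContactFreeNonPrincipalInLocusTowersTerminate n) (hPu : PurePrincipalTowersTerminate n)
    (hR : IncommensurableWildDriftingImperfectTowersTerminate n)
    (hlow : ∀ n' : ℕ, 1 ≤ n' → n' < n → ForcedTowersTerminate n') : ForcedTowersTerminate n :=
  ftt_step_of_g42 hn hMo hC hSL hH hP hM hRi h71 surfaceChainPort_holds hB
    (wildOccultDivisorialThreefoldNonLineRecurrentCompanionCurveFreeBirthRecurrentCofactorBirthRecurrentNarrowCofactorNarrowFlagProperConeMixed_holds n hn) hC4 hD4 hNP hPu hR hlow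

/-- **`∀ n ≥ 1, ForcedTowersTerminate n` by strong induction on the weight**, `hcore` and `h640` discharged. [folklore] -/
theorem forcedTowersTerminate_of_g43 (hMo : MaxContactCut.MonomialCornerAll) (hC : MaxContactCut.CurveLawAll)
    (hSL : MaxContactCut.SurfaceLawAll) (hH : MaxContactCut.NoHypersurfaceHuggingTowers) (hP : ShadowPortAll)
    (hM : MarkingPortAll) (hRi : RiderPortAll) (h71 : MaxContactCut.NoContactHuggingTowers)
    (hB : NoWildLatentFactorNonThreefoldMixedTowers)
    (hC4 : NoWildOccultDivisorialNonThreefoldMixedTowers) (hD4 : NoWildOccultNonDivisorialNonThreefoldMixedTowers)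
    (hNP : NoContactFreeNonPrincipalInLocusTowers) (hPu : NoPurePrincipalTowers) (hR : NoIncommensurableWildDriftingImperfectTowers) :
    ∀ n : ℕ, 1 ≤ n → ForcedTowersTerminate n :=
  forcedTowersTerminate_of_g42 hMo hC hSL hH hP hM hRi h71 surfaceChainPort_holds hB
    (fun n hn _ => wildOccultDivisorialThreefoldNonLineRecurrentCompanionCurveFreeBirthRecurrentCofactorBirthRecurrentNarrowCofactorNarrowFlagProperConeMixed_holds n hn) hC4 hD4 hNP hPu hR

/-- **30253 `MaxContactCut.NoForcedTowers` BY NAME from the g43 cells: g42's root consumer with the located core `hcore` KILLED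
ABSOLUTELY (LAW D) and the port `h640 : SurfaceChainPort` PROVED — the other 14 binders verbatim.**  NOT a proof of
`MaxContactCut.NoForcedTowers` outright: the structural ports (`hMo hC hSL hP hM hRi`), the hugging columns (`hH h71`), the
non-threefold mixed cells (`hB hC4 hD4`) and the latency / purity / rider leaves (`hNP hPu hR`) remain hypotheses. [folklore] -/
theorem noForcedTowers_of_g43 (hMo : MaxContactCut.MonomialCornerAll) (hC : MaxContactCut.CurveLawAll)
    (hSL : MaxContactCut.SurfaceLawAll) (hH : MaxContactCut.NoHypersurfaceHuggingTowers) (hP : ShadowPortAll)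
    (hM : MarkingPortAll) (hRi : RiderPortAll) (h71 : MaxContactCut.NoContactHuggingTowers)
    (hB : NoWildLatentFactorNonThreefoldMixedTowers)
    (hC4 : NoWildOccultDivisorialNonThreefoldMixedTowers) (hD4 : NoWildOccultNonDivisorialNonThreefoldMixedTowers)
    (hNP : NoContactFreeNonPrincipalInLocusTowers) (hPu : NoPurePrincipalTowers) (hR : NoIncommensurableWildDriftingImperfectTowers) :
    MaxContactCut.NoForcedTowers :=
  noForcedTowers_of_g42 hMo hC hSL hH hP hM hRi h71 surfaceChainPort_holds hB
    (fun n hn _ => wildOccultDivisorialThreefoldNonLineRecurrentCompanionCurveFreeBirthRecurrentCofactorBirthRecurrentNarrowCofactorNarrowFlagProperConeMixed_holds n hn) hC4 hD4 hNP hPu hR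

/-- the same from the ABSOLUTE g43 located residual `NoWildOccultNonThreefoldMixedTowers` by name (13 binders). [folklore] -/
theorem noForcedTowers_of_g43_residual (hMo : MaxContactCut.MonomialCornerAll) (hC : MaxContactCut.CurveLawAll)
    (hSL : MaxContactCut.SurfaceLawAll) (hH : MaxContactCut.NoHypersurfaceHuggingTowers) (hP : ShadowPortAll)
    (hM : MarkingPortAll) (hRi : RiderPortAll) (h71 : MaxContactCut.NoContactHuggingTowers)
    (hB : NoWildLatentFactorNonThreefoldMixedTowers) (hres : NoWildOccultNonThreefoldMixedTowers)
    (hNP : NoContactFreeNonPrincipalInLocusTowers) (hPu : NoPurePrincipalTowers) (hR : NoIncommensurableWildDriftingImperfectTowers) :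
    MaxContactCut.NoForcedTowers :=
  noForcedTowers_of_g43 hMo hC hSL hH hP hM hRi h71 hB hres.1 hres.2 hNP hPu hR

/-- **MAP RIDER — the Literature fact `CJS2020_noInfiniteNearChain_eTwo` (CossartJannsenSaito2020 Thm. 6.40 for principal point chains,
«weaker than print», an untagged `def : Prop` of `Literature/…/NearChainTerminationETwoScheme`) DISCHARGED IN THE KERNEL** through the
landed bridge `surfaceChainPort_iff_CJS2020` (Theorems/SurfacePortBridge). [cite: CossartJannsenSaito2020, Thm. 6.40] -/
theorem cjs2020_noInfiniteNearChain_eTwo_holds : Literature.AlgebraicGeometry.Resolution.CJS2020_noInfiniteNearChain_eTwo :=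
  surfaceChainPort_iff_CJS2020.mp surfaceChainPort_holds

end PolygonLawRoot

end Summit.ResolutionOfSingularities.ResolutionOfSingularities.Theorems.HugValuationCut

end
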